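import Mathlib
import Literature.Analysis.OperatorTheory.PowTendstoZeroGeometric

/-!
# Power-bounded operators on finite-dimensional spaces: the idempotent splitting,
# and decay of weakly-null orbit families

Let `E` be a finite-dimensional complex normed space and `A : E →L[ℂ] E` an operator all of
whose orbits are bounded (equivalently, by Banach–Steinhaus, `A` is power-bounded).  The closure
of `{A^k : k ≥ 1}` is a compact commutative semigroup, so by the Ellis–Numakura lemma it contains
an idempotent `P`; `P` commutes with `A`, `A^{e_j} → P` along a sequence `e_j → ∞`, and
`A^k y → 0` for every `y ∈ ker P` (Jacobs–de Leeuw–Glicksberg splitting in finite dimensions,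
[folklore]; cf. Ellis–Numakura `exists_idempotent_of_compact_t2_of_continuous_mul_left`).

Application (the form used for Kirillov-model asymptotics of cusp forms): if `s : Ω → E` is a
bounded measurable family on a finite measure space whose orbit functions `ω ↦ A^k (s ω)` tend to
`0` *weakly* (against `1_B ⊗ ℓ`), then `P (s ω) = 0` a.e., hence `A^k (s ω) → 0` a.e.
-/

open Filter Topology MeasureTheory

namespace Literature.Analysis.OperatorTheory

variable {E : Type*} [NormedAddCommGroup E] [NormedSpace ℂ E]

/-- A sequence of natural numbers either takes some value frequently or tends to infinity. [folklore] -/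
theorem nat_seq_frequently_eq_or_tendsto_atTop (k : ℕ → ℕ) :
    (∃ m, ∃ᶠ n in atTop, k n = m) ∨ Tendsto k atTop atTop := by
  by_cases h : ∃ m, ∃ᶠ n in atTop, k n = m
  · exact Or.inl h
  · right
    push Not at h
    rw [tendsto_atTop]
    intro N
    have : ∀ m < N, ∀ᶠ n in atTop, k n ≠ m := fun m _ => h m
    have hall : ∀ᶠ n in atTop, ∀ m < N, k n ≠ m := by
      induction N with
      | zero => exact Eventually.of_forall fun n m hm => (Nat.not_lt_zero m hm).elim
      | succ N ih =>
        have ih' := ih (fun m hm => this m (Nat.lt_succ_of_lt hm))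
        filter_upwards [ih', this N (Nat.lt_succ_self N)] with n h1 h2 m hm
        rcases Nat.lt_succ_iff_lt_or_eq.1 hm with hm | hm
        · exact h1 m hm
        · exact hm ▸ h2
    filter_upwards [hall] with n hn
    by_contra hlt
    push Not at hlt
    exact hn (k n) hlt rfl

section Splitting

variable [FiniteDimensional ℂ E]

/-- Power-boundedness from bounded orbits (Banach–Steinhaus). [folklore] -/
theorem exists_opNorm_pow_le_of_bounded_orbits (A : E →L[ℂ] E)
    (hb : ∀ y, ∃ C, ∀ k, ‖(A ^ k) y‖ ≤ C) : ∃ M, 0 < M ∧ ∀ k, ‖A ^ k‖ ≤ M := by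
  haveI : CompleteSpace E := FiniteDimensional.complete ℂ E
  obtain ⟨C, hC⟩ := banach_steinhaus (g := fun k : ℕ => A ^ k) hb
  exact ⟨max C 1, lt_of_lt_of_le one_pos (le_max_right _ _), fun k => (hC k).trans (le_max_left _ _)⟩

/-- **Idempotent splitting** of a power-bounded operator on a finite-dimensional space: there is
an idempotent `P` commuting with `A` and a sequence `e → ∞` with `A^{e j} → P` (in operator
norm). [folklore] -/
theorem exists_idempotent_limit_of_bounded_orbits (A : E →L[ℂ] E)
    (hb : ∀ y, ∃ C, ∀ k, ‖(A ^ k) y‖ ≤ C) :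
    ∃ (P : E →L[ℂ] E) (e : ℕ → ℕ), P * P = P ∧ P * A = A * P ∧ Tendsto e atTop atTop ∧
      Tendsto (fun j => A ^ (e j)) atTop (𝓝 P) := by
  obtain ⟨M, _, hM⟩ := exists_opNorm_pow_le_of_bounded_orbits A hb
  -- the compact semigroup `S = closure {A^(k+1)}`
  set T : Set (E →L[ℂ] E) := Set.range fun k : ℕ => A ^ (k + 1) with hT
  set S : Set (E →L[ℂ] E) := closure T with hS
  have hTmul : ∀ x ∈ T, ∀ y ∈ T, x * y ∈ T := by
    rintro x ⟨a, rfl⟩ y ⟨b, rfl⟩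
    exact ⟨a + 1 + b, by rw [← pow_add]; simp only; congr 1⟩
  have hSmul : ∀ x ∈ S, ∀ y ∈ S, x * y ∈ S := fun x hx y hy =>
    map_mem_closure₂ continuous_mul hx hy hTmul
  have hScomm : ∀ x ∈ S, ∀ y ∈ S, x * y = y * x := by
    have hTcomm : ∀ x ∈ T, ∀ y ∈ T, x * y = y * x := by
      rintro x ⟨a, rfl⟩ y ⟨b, rfl⟩
      rw [← pow_add, ← pow_add, add_comm]
    intro x hx y hy
    have h1 : ∀ y ∈ T, ∀ x ∈ S, x * y = y * x := by
      intro y hy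
      apply fun x hx => (isClosed_eq (continuous_id.mul continuous_const)
        (continuous_const.mul continuous_id)).closure_subset_iff.2 (fun x hx => hTcomm x hx y hy) hx
    exact (isClosed_eq (continuous_const.mul continuous_id)
        (continuous_id.mul continuous_const)).closure_subset_iff.2 (fun y hy => h1 y hy x hx) hy
  have hSbdd : Bornology.IsBounded S := by
    refine (Metric.isBounded_iff_subset_closedBall (0 : E →L[ℂ] E)).2 ⟨M, ?_⟩
    refine closure_minimal ?_ Metric.isClosed_closedBall
    rintro x ⟨a, rfl⟩
    simpa using hM (a + 1)
  haveI : ProperSpace (E →L[ℂ] E) := FiniteDimensional.proper ℂ (E →L[ℂ] E)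
  have hScpt : IsCompact S := Metric.isCompact_of_isClosed_isBounded isClosed_closure hSbdd
  have hSne : S.Nonempty := ⟨A ^ (0 + 1), subset_closure ⟨0, rfl⟩⟩
  -- Ellis–Numakura on the subtype
  let Ssub : Type _ := {x // x ∈ S}
  letI : Semigroup Ssub :=
    { mul := fun x y => ⟨x.1 * y.1, hSmul _ x.2 _ y.2⟩
      mul_assoc := fun x y z => Subtype.ext (mul_assoc x.1 y.1 z.1) }
  haveI : CompactSpace Ssub := isCompact_iff_compactSpace.1 hScpt
  haveI : Nonempty Ssub := hSne.to_subtype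
  have hcont : ∀ r : Ssub, Continuous (· * r) := fun r =>
    (continuous_subtype_val.mul continuous_const).subtype_mk _
  obtain ⟨P, hPP⟩ := exists_idempotent_of_compact_t2_of_continuous_mul_left hcont
  have hPP' : P.1 * P.1 = P.1 := congrArg Subtype.val hPP
  -- a sequence of powers converging to `P`
  obtain ⟨x, hxT, hxP⟩ := mem_closure_iff_seq_limit.1 P.2
  choose k hk using fun n => (hxT n)
  have hxk : ∀ n, x n = A ^ (k n + 1) := fun n => (hk n).symm
  have hPA : P.1 * A = A * P.1 := by
    have hAS : A ∈ S := subset_closure ⟨0, by simp⟩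
    exact hScomm _ P.2 _ hAS
  rcases nat_seq_frequently_eq_or_tendsto_atTop k with ⟨m, hm⟩ | hkt
  · -- `P = A^(m+1)`, use the multiples
    obtain ⟨φ, hφ, hφm⟩ := extraction_of_frequently_atTop hm
    have hPeq : P.1 = A ^ (m + 1) := by
      have h1 : Tendsto (fun n => x (φ n)) atTop (𝓝 P.1) := hxP.comp hφ.tendsto_atTop
      have h2 : (fun n => x (φ n)) = fun _ => A ^ (m + 1) := by
        funext n; rw [hxk, hφm]
      rw [h2, tendsto_const_nhds_iff] at h1
      exact h1.symm
    have hpow : ∀ j : ℕ, A ^ ((m + 1) * (j + 1)) = P.1 := by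
      intro j
      induction j with
      | zero => simpa using hPeq.symm
      | succ j ih =>
        rw [show (m + 1) * (j + 1 + 1) = (m + 1) * (j + 1) + (m + 1) by ring, pow_add, ih,
          ← hPeq, hPP']
    refine ⟨P.1, fun j => (m + 1) * (j + 1), hPP', hPA, ?_, ?_⟩
    · exact tendsto_atTop_atTop.2 fun N => ⟨N, fun j hj => by nlinarith⟩
    · simp_rw [hpow]; exact tendsto_const_nhds
  · refine ⟨P.1, fun n => k n + 1, hPP', hPA, ?_, ?_⟩
    · exact tendsto_atTop_atTop.2 fun N =>
        let ⟨n₀, hn₀⟩ := tendsto_atTop_atTop.1 hkt N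
        ⟨n₀, fun n hn => (hn₀ n hn).trans (Nat.le_succ _)⟩
    · have : (fun n => A ^ (k n + 1)) = x := funext fun n => (hxk n).symm
      rw [this]; exact hxP

/-- The splitting theorem with its two dynamical consequences: orbits in `ker P` tend to zero,
and `A^{e j} y → P y` for every `y`. [folklore] -/
theorem exists_idempotent_splitting (A : E →L[ℂ] E)
    (hb : ∀ y, ∃ C, ∀ k, ‖(A ^ k) y‖ ≤ C) :
    ∃ (P : E →L[ℂ] E) (e : ℕ → ℕ), P * P = P ∧ P * A = A * P ∧ Tendsto e atTop atTop ∧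
      (∀ y, Tendsto (fun j => (A ^ (e j)) y) atTop (𝓝 (P y))) ∧
      (∀ y, P y = 0 → Tendsto (fun k => (A ^ k) y) atTop (𝓝 0)) := by
  obtain ⟨M, hM0, hM⟩ := exists_opNorm_pow_le_of_bounded_orbits A hb
  obtain ⟨P, e, hPP, hPA, he, hlim⟩ := exists_idempotent_limit_of_bounded_orbits A hb
  have hpt : ∀ y, Tendsto (fun j => (A ^ (e j)) y) atTop (𝓝 (P y)) := fun y =>
    (ContinuousLinearMap.apply ℂ E y).continuous.continuousAt.tendsto.comp hlim
  refine ⟨P, e, hPP, hPA, he, hpt, fun y hy => ?_⟩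
  rw [Metric.tendsto_atTop]
  intro ε hε
  have h1 := hpt y
  rw [hy, Metric.tendsto_atTop] at h1
  obtain ⟨j, hj⟩ := h1 (ε / (M + 1)) (by positivity)
  refine ⟨e j, fun n hn => ?_⟩
  have hsplit : (A ^ n) y = (A ^ (n - e j)) ((A ^ (e j)) y) := by
    rw [show (A ^ (n - e j)) ((A ^ e j) y) = (A ^ (n - e j) * A ^ e j) y from rfl, ← pow_add, Nat.sub_add_cancel hn]
  have hj' : ‖(A ^ (e j)) y‖ < ε / (M + 1) := by simpa using hj j le_rfl
  rw [dist_zero_right, hsplit]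
  calc ‖(A ^ (n - e j)) ((A ^ e j) y)‖ ≤ ‖A ^ (n - e j)‖ * ‖(A ^ e j) y‖ :=
        ContinuousLinearMap.le_opNorm _ _
    _ ≤ M * (ε / (M + 1)) := by
        apply mul_le_mul (hM _) hj'.le (norm_nonneg _) hM0.le
    _ < ε := by
        rw [mul_div_assoc']
        rw [div_lt_iff₀ (by positivity)]
        nlinarith

end Splitting

section Rate

variable [FiniteDimensional ℂ E]

/-- Powers of the restriction of `A` to an invariant submodule agree with powers of `A`. [folklore] -/
theorem restrict_pow_apply_coe (A : E →L[ℂ] E) (K : Submodule ℂ E)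
    (hK : ∀ y ∈ K, A y ∈ K) (k : ℕ) (y : K) :
    ((((A.toLinearMap.restrict hK).toContinuousLinearMap) ^ k) y : E) = (A ^ k) (y : E) := by
  induction k generalizing y with
  | zero => simp
  | succ k ih =>
    rw [pow_succ, pow_succ]
    show (((A.toLinearMap.restrict hK).toContinuousLinearMap ^ k)
      ((A.toLinearMap.restrict hK).toContinuousLinearMap y) : E) = (A ^ k) (A y)
    rw [ih]
    rfl

/-- **Splitting with a uniform geometric rate on the stable part.**  For an operator with
bounded orbits on a finite-dimensional complex space: an idempotent `P` commuting with `A`,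
a sequence `e → ∞` with `A^{e j} y → P y`, and constants `C > 0`, `0 < θ < 1` with
`‖A^k y‖ ≤ C θ^k ‖y‖` for every `y ∈ ker P`. [folklore] -/
theorem exists_idempotent_splitting_geometric (A : E →L[ℂ] E)
    (hb : ∀ y, ∃ C, ∀ k, ‖(A ^ k) y‖ ≤ C) :
    ∃ (P : E →L[ℂ] E) (e : ℕ → ℕ) (C θ : ℝ), P * P = P ∧ P * A = A * P ∧
      Tendsto e atTop atTop ∧ (∀ y, Tendsto (fun j => (A ^ (e j)) y) atTop (𝓝 (P y))) ∧
      0 < C ∧ 0 < θ ∧ θ < 1 ∧ ∀ y, P y = 0 → ∀ k, ‖(A ^ k) y‖ ≤ C * θ ^ k * ‖y‖ := by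
  obtain ⟨P, e, hPP, hPA, he, hpt, hker⟩ := exists_idempotent_splitting A hb
  set K : Submodule ℂ E := LinearMap.ker P.toLinearMap with hKdef
  have hK : ∀ y ∈ K, A y ∈ K := by
    intro y hy
    simp only [hKdef, LinearMap.mem_ker, ContinuousLinearMap.coe_coe] at hy ⊢
    have this : P (A y) = A (P y) := congrArg (fun T : E →L[ℂ] E => T y) hPA
    rw [this, hy, map_zero]
  set AK : K →L[ℂ] K := (A.toLinearMap.restrict hK).toContinuousLinearMap with hAK
  have hAKt : ∀ y : K, Tendsto (fun k => (AK ^ k) y) atTop (𝓝 0) := by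
    intro y
    have h1 : Tendsto (fun k => ((AK ^ k) y : E)) atTop (𝓝 0) := by
      simp_rw [hAK, restrict_pow_apply_coe]
      exact hker y (LinearMap.mem_ker.1 y.2)
    refine (Topology.IsEmbedding.subtypeVal.tendsto_nhds_iff).2 ?_
    simpa [Function.comp_def] using h1
  obtain ⟨C, θ, hC, hθ0, hθ1, hbound⟩ := exists_geometric_opNorm_pow_le_of_forall_tendsto AK hAKt
  refine ⟨P, e, C, θ, hPP, hPA, he, hpt, hC, hθ0, hθ1, fun y hy k => ?_⟩
  have hyK : y ∈ K := by simpa [hKdef] using hy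
  have h1 : ‖(AK ^ k) ⟨y, hyK⟩‖ ≤ C * θ ^ k * ‖(⟨y, hyK⟩ : K)‖ :=
    (ContinuousLinearMap.le_opNorm _ _).trans (mul_le_mul_of_nonneg_right (hbound k) (norm_nonneg _))
  have h2 : ‖(AK ^ k) ⟨y, hyK⟩‖ = ‖(A ^ k) y‖ := by
    rw [Submodule.coe_norm, hAK, restrict_pow_apply_coe]
  have h3 : ‖(⟨y, hyK⟩ : K)‖ = ‖y‖ := rfl
  rwa [h2, h3] at h1

end Rate

section WeakNull

variable [FiniteDimensional ℂ E] {Ω : Type*} [MeasurableSpace Ω] {μ : Measure Ω}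

/-- **Weakly null orbit families lie in the stable part.**  Let `s : Ω → E` be bounded and
measurable on a finite measure space, and suppose the orbit functions `ω ↦ A^k (s ω)` tend to
zero weakly, tested against `1_B ⊗ ℓ` for measurable `B` and functionals `ℓ`.  Then, with `P`
the idempotent of `exists_idempotent_splitting_geometric`, `P (s ω) = 0` for a.e. `ω`; in
particular `‖A^k (s ω)‖ ≤ C θ^k ‖s ω‖` a.e., with `θ < 1` independent of `ω`. [folklore] -/
theorem ae_geometric_decay_of_weakNull [IsFiniteMeasure μ] (A : E →L[ℂ] E)
    (hb : ∀ y, ∃ C, ∀ k, ‖(A ^ k) y‖ ≤ C) {s : Ω → E} (hs : AEStronglyMeasurable s μ)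
    {R : ℝ} (hR : ∀ ω, ‖s ω‖ ≤ R)
    (hw : ∀ (ℓ : E →L[ℂ] ℂ) (B : Set Ω), MeasurableSet B →
      Tendsto (fun k => ∫ ω in B, ℓ ((A ^ k) (s ω)) ∂μ) atTop (𝓝 0)) :
    ∃ (C θ : ℝ), 0 < C ∧ 0 < θ ∧ θ < 1 ∧
      ∀ᵐ ω ∂μ, ∀ k, ‖(A ^ k) (s ω)‖ ≤ C * θ ^ k * ‖s ω‖ := by
  obtain ⟨M, hM0, hM⟩ := exists_opNorm_pow_le_of_bounded_orbits A hb
  obtain ⟨P, e, C, θ, _, _, he, hpt, hC, hθ0, hθ1, hdec⟩ :=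
    exists_idempotent_splitting_geometric A hb
  refine ⟨C, θ, hC, hθ0, hθ1, ?_⟩
  -- Step 1: `∫_B ℓ (P (s ω)) = 0` for every `ℓ`, `B`.
  have hint0 : ∀ (ℓ : E →L[ℂ] ℂ) (B : Set Ω), MeasurableSet B →
      ∫ ω in B, ℓ (P (s ω)) ∂μ = 0 := by
    intro ℓ B hB
    have hlim : Tendsto (fun j => ∫ ω in B, ℓ ((A ^ (e j)) (s ω)) ∂μ) atTop
        (𝓝 (∫ ω in B, ℓ (P (s ω)) ∂μ)) := by
      refine tendsto_integral_of_dominated_convergence (fun _ => ‖ℓ‖ * (M * R)) ?_ ?_ ?_ ?_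
      · intro j
        exact ((ℓ.comp (A ^ (e j))).continuous.comp_aestronglyMeasurable hs).restrict
      · exact integrable_const _
      · intro j
        refine Eventually.of_forall fun ω => ?_
        calc ‖ℓ ((A ^ (e j)) (s ω))‖ ≤ ‖ℓ‖ * ‖(A ^ (e j)) (s ω)‖ := ℓ.le_opNorm _
          _ ≤ ‖ℓ‖ * (M * R) := by
            refine mul_le_mul_of_nonneg_left ?_ (norm_nonneg _)
            exact ((A ^ (e j)).le_opNorm _).trans
              (mul_le_mul (hM _) (hR ω) (norm_nonneg _) hM0.le)
      · exact Eventually.of_forall fun ω =>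
          (ℓ.continuous.tendsto _).comp (hpt (s ω))
    exact tendsto_nhds_unique hlim ((hw ℓ B hB).comp he)
  -- Step 2: `ℓ (P (s ω)) = 0` a.e. for every `ℓ`.
  have hae : ∀ ℓ : E →L[ℂ] ℂ, ∀ᵐ ω ∂μ, ℓ (P (s ω)) = 0 := by
    intro ℓ
    have hInt : Integrable (fun ω => ℓ (P (s ω))) μ := by
      refine (integrable_const (‖ℓ‖ * (‖P‖ * R))).mono'
        ((ℓ.comp P).continuous.comp_aestronglyMeasurable hs) (Eventually.of_forall fun ω => ?_)
      calc ‖ℓ (P (s ω))‖ ≤ ‖ℓ‖ * ‖P (s ω)‖ := ℓ.le_opNorm _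
        _ ≤ ‖ℓ‖ * (‖P‖ * R) := mul_le_mul_of_nonneg_left
            ((P.le_opNorm _).trans (mul_le_mul_of_nonneg_left (hR ω) (norm_nonneg _)))
            (norm_nonneg _)
    have := hInt.ae_eq_zero_of_forall_setIntegral_eq_zero (fun B hB _ => hint0 ℓ B hB)
    filter_upwards [this] with ω hω using hω
  -- Step 3: coordinates of a basis.
  let b := Module.finBasis ℂ E
  have hcoord : ∀ᵐ ω ∂μ, ∀ i, (b.coord i) (P (s ω)) = 0 := by
    rw [ae_all_iff]
    intro i
    exact hae (LinearMap.toContinuousLinearMap (b.coord i))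
  filter_upwards [hcoord] with ω hω
  have hP0 : P (s ω) = 0 := b.forall_coord_eq_zero_iff.1 hω
  exact hdec _ hP0

end WeakNull

section WeakNullContinuous

variable [FiniteDimensional ℂ E] {Ω : Type*} [TopologicalSpace Ω] [MeasurableSpace Ω]
  [OpensMeasurableSpace Ω] [T2Space Ω] [LocallyCompactSpace Ω] {μ : Measure Ω}
  [IsFiniteMeasureOnCompacts μ] [μ.IsOpenPosMeasure]

/-- **Weakly null continuous orbit families decay geometrically** (power-bounded case).  Let
`s : Ω → E` be continuous, `A` with bounded orbits, `U ⊆ Ω` open, and suppose that for every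
functional `ℓ` and every continuous compactly supported `F` with `tsupport F ⊆ U`,
`∫ F ω · ℓ (A^k (s ω)) dμ → 0`.  Then `‖A^k (s ω)‖ ≤ C θ^k ‖s ω‖` for all `ω ∈ U`, with
`θ < 1`. [folklore] -/
theorem geometric_decay_of_weakNull_continuous (A : E →L[ℂ] E)
    (hb : ∀ y, ∃ C, ∀ k, ‖(A ^ k) y‖ ≤ C) {U : Set Ω} (hU : IsOpen U) {s : Ω → E}
    (hs : Continuous s)
    (hw : ∀ (ℓ : E →L[ℂ] ℂ) (F : Ω → ℂ), Continuous F → HasCompactSupport F →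
      tsupport F ⊆ U → Tendsto (fun k => ∫ ω, F ω * ℓ ((A ^ k) (s ω)) ∂μ) atTop (𝓝 0)) :
    ∃ (C θ : ℝ), 0 < C ∧ 0 < θ ∧ θ < 1 ∧
      ∀ ω ∈ U, ∀ k, ‖(A ^ k) (s ω)‖ ≤ C * θ ^ k * ‖s ω‖ := by
  obtain ⟨M, hM0, hM⟩ := exists_opNorm_pow_le_of_bounded_orbits A hb
  obtain ⟨P, e, C, θ, _, _, he, hpt, hC, hθ0, hθ1, hdec⟩ :=
    exists_idempotent_splitting_geometric A hb
  refine ⟨C, θ, hC, hθ0, hθ1, fun ω₀ hω₀ k => hdec _ ?_ k⟩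
  -- Show `P (s ω₀) = 0` by testing against a bump at `ω₀`.
  by_contra hne
  let b := Module.finBasis ℂ E
  obtain ⟨i, hi⟩ : ∃ i, (b.coord i) (P (s ω₀)) ≠ 0 := by
    by_contra h
    push Not at h
    exact hne (b.forall_coord_eq_zero_iff.1 h)
  set ℓ : E →L[ℂ] ℂ := LinearMap.toContinuousLinearMap (b.coord i) with hℓ
  have hℓi : ℓ (P (s ω₀)) ≠ 0 := hi
  -- bump function supported in a compact subset of `U`
  obtain ⟨K, hKc, hK0, hKU⟩ := exists_compact_subset hU hω₀
  obtain ⟨χ, hχ1, hχ0, hχc, hχ01⟩ := exists_continuous_one_zero_of_isCompact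
    (isCompact_singleton (x := ω₀)) isOpen_interior.isClosed_compl
    (Set.disjoint_singleton_left.2 (fun h => h hK0))
  have hχω₀ : χ ω₀ = 1 := hχ1 rfl
  have hχsupp : Function.support χ ⊆ interior K := by
    intro ω hω
    by_contra hω'
    exact hω (hχ0 hω')
  have hχtsupp : tsupport χ ⊆ U :=
    (closure_mono hχsupp).trans ((closure_mono interior_subset).trans
      (hKc.isClosed.closure_subset.trans hKU))
  set G : Ω → ℂ := fun ω => ℓ (P (s ω)) with hG
  have hGc : Continuous G := (ℓ.comp P).continuous.comp hs
  set F : Ω → ℂ := fun ω => (χ ω : ℂ) * (starRingEnd ℂ) (G ω) with hF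
  have hFc : Continuous F :=
    (Complex.continuous_ofReal.comp χ.continuous).mul (Complex.continuous_conj.comp hGc)
  have hFsupp : Function.support F ⊆ Function.support χ := by
    intro ω hω
    simp only [hF, Function.mem_support, ne_eq, mul_eq_zero, Complex.ofReal_eq_zero, not_or] at hω
    exact hω.1
  have hFcs : HasCompactSupport F := hχc.mono hFsupp
  have hFts : tsupport F ⊆ U := (closure_mono hFsupp).trans hχtsupp
  -- bound for `s` on the compact `tsupport F`
  obtain ⟨R, hR⟩ := hFcs.isCompact.exists_bound_of_continuousOn hs.continuousOn
  have hR0 : 0 ≤ R := by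
    by_cases hω : ω₀ ∈ tsupport F
    · exact (norm_nonneg _).trans (hR _ hω)
    · exfalso
      have : F ω₀ = 0 := image_eq_zero_of_notMem_tsupport hω
      simp only [hF, hχω₀, Complex.ofReal_one, one_mul, map_eq_zero] at this
      exact hℓi this
  -- dominated convergence along `e`
  have hlim : Tendsto (fun j => ∫ ω, F ω * ℓ ((A ^ (e j)) (s ω)) ∂μ) atTop
      (𝓝 (∫ ω, F ω * G ω ∂μ)) := by
    refine tendsto_integral_of_dominated_convergence (fun ω => ‖F ω‖ * (‖ℓ‖ * (M * R)))
      ?_ ?_ ?_ ?_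
    · intro j
      exact (hFc.mul ((ℓ.comp (A ^ (e j))).continuous.comp hs)).aestronglyMeasurable
    · exact ((hFc.norm).mul continuous_const).integrable_of_hasCompactSupport
        (hFcs.norm.mul_right)
    · intro j
      refine Eventually.of_forall fun ω => ?_
      by_cases hω : ω ∈ tsupport F
      · rw [norm_mul]
        refine mul_le_mul_of_nonneg_left ?_ (norm_nonneg _)
        calc ‖ℓ ((A ^ (e j)) (s ω))‖ ≤ ‖ℓ‖ * ‖(A ^ (e j)) (s ω)‖ := ℓ.le_opNorm _
          _ ≤ ‖ℓ‖ * (M * R) := by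
            refine mul_le_mul_of_nonneg_left ?_ (norm_nonneg _)
            exact ((A ^ (e j)).le_opNorm _).trans
              (mul_le_mul (hM _) (hR ω hω) (norm_nonneg _) hM0.le)
      · have hF0 : F ω = 0 := image_eq_zero_of_notMem_tsupport hω
        simp [hF0]
    · exact Eventually.of_forall fun ω =>
        ((continuous_const.mul ℓ.continuous).tendsto _).comp (hpt (s ω))
  have hzero : ∫ ω, F ω * G ω ∂μ = 0 :=
    tendsto_nhds_unique hlim ((hw ℓ F hFc hFcs hFts).comp he)
  have hFG : ∀ ω, F ω * G ω = ((χ ω * ‖G ω‖ ^ 2 : ℝ) : ℂ) := by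
    intro ω
    simp only [hF]
    rw [mul_assoc, Complex.conj_mul', Complex.ofReal_mul]
    push_cast
    ring
  have hreal : ∫ ω, F ω * G ω ∂μ = ((∫ ω, χ ω * ‖G ω‖ ^ 2 ∂μ : ℝ) : ℂ) := by
    simp_rw [hFG]
    exact integral_ofReal
  have hsupp2 : HasCompactSupport (fun ω => χ ω * ‖G ω‖ ^ 2) :=
    hχc.mono (fun ω hω => by
      simp only [Function.mem_support, ne_eq, mul_eq_zero, not_or] at hω
      exact hω.1)
  have hpos : 0 < ∫ ω, χ ω * ‖G ω‖ ^ 2 ∂μ := by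
    refine Continuous.integral_pos_of_hasCompactSupport_nonneg_nonzero (x := ω₀)
      (χ.continuous.mul (hGc.norm.pow 2)) hsupp2 (fun ω => ?_) ?_
    · exact mul_nonneg (hχ01 ω).1 (sq_nonneg _)
    · rw [hχω₀, one_mul]
      exact pow_ne_zero _ (norm_ne_zero_iff.2 hℓi)
  rw [hreal] at hzero
  exact absurd (Complex.ofReal_eq_zero.1 hzero) hpos.ne'

/-- **Main theorem (bounded orbits only along the family).**  As
`geometric_decay_of_weakNull_continuous`, but the orbit bound is only required for the vectors
`s ω`, `ω ∈ U` (the operator is restricted to the invariant hull they span). [folklore] -/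
theorem geometric_decay_of_weakNull_continuous' (A : E →L[ℂ] E) {U : Set Ω} (hU : IsOpen U)
    {s : Ω → E} (hs : Continuous s) (hb : ∀ ω ∈ U, ∃ C, ∀ k, ‖(A ^ k) (s ω)‖ ≤ C)
    (hw : ∀ (ℓ : E →L[ℂ] ℂ) (F : Ω → ℂ), Continuous F → HasCompactSupport F →
      tsupport F ⊆ U → Tendsto (fun k => ∫ ω, F ω * ℓ ((A ^ k) (s ω)) ∂μ) atTop (𝓝 0)) :
    ∃ (C θ : ℝ), 0 < C ∧ 0 < θ ∧ θ < 1 ∧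
      ∀ ω ∈ U, ∀ k, ‖(A ^ k) (s ω)‖ ≤ C * θ ^ k * ‖s ω‖ := by
  -- the invariant hull
  set S₀ : Set E := {y | ∃ ω ∈ U, ∃ k : ℕ, y = (A ^ k) (s ω)} with hS₀
  set E' : Submodule ℂ E := Submodule.span ℂ S₀ with hE'
  have hAS₀ : ∀ y ∈ S₀, A y ∈ S₀ := by
    rintro y ⟨ω, hω, k, rfl⟩
    exact ⟨ω, hω, k + 1, by rw [pow_succ']; rfl⟩
  have hE'A : ∀ y ∈ E', A y ∈ E' := by
    intro y hy
    refine Submodule.span_induction (p := fun y _ => A y ∈ E') ?_ ?_ ?_ ?_ hy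
    · exact fun y hy => Submodule.subset_span (hAS₀ y hy)
    · simp
    · intro x y _ _ hx hy
      rw [map_add]; exact E'.add_mem hx hy
    · intro c x _ hx
      rw [map_smul]; exact E'.smul_mem c hx
  have hsmem : ∀ ω ∈ U, s ω ∈ E' := fun ω hω =>
    Submodule.subset_span ⟨ω, hω, 0, by simp⟩
  -- restricted operator and its bounded orbits
  set A' : E' →L[ℂ] E' := (A.toLinearMap.restrict hE'A).toContinuousLinearMap with hA'
  have hA'pow : ∀ (k : ℕ) (y : E'), (((A' ^ k) y : E') : E) = (A ^ k) (y : E) :=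
    fun k y => restrict_pow_apply_coe A E' hE'A k y
  have hb' : ∀ y : E', ∃ C, ∀ k, ‖(A' ^ k) y‖ ≤ C := by
    intro y
    suffices h : ∃ C, ∀ k, ‖(A ^ k) (y : E)‖ ≤ C by
      obtain ⟨C, hC⟩ := h
      exact ⟨C, fun k => by rw [Submodule.coe_norm, hA'pow]; exact hC k⟩
    refine Submodule.span_induction (p := fun y _ => ∃ C, ∀ k, ‖(A ^ k) y‖ ≤ C)
      ?_ ?_ ?_ ?_ y.2
    · rintro y ⟨ω, hω, j, rfl⟩
      obtain ⟨C, hC⟩ := hb ω hω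
      refine ⟨C, fun k => ?_⟩
      rw [show (A ^ k) ((A ^ j) (s ω)) = (A ^ k * A ^ j) (s ω) from rfl, ← pow_add]
      exact hC _
    · exact ⟨0, fun k => by simp⟩
    · rintro x y - - ⟨C₁, h₁⟩ ⟨C₂, h₂⟩
      exact ⟨C₁ + C₂, fun k => by rw [map_add]; exact norm_add_le_of_le (h₁ k) (h₂ k)⟩
    · rintro c x - ⟨C, hC⟩
      exact ⟨‖c‖ * C, fun k => by
        rw [map_smul, norm_smul]; exact mul_le_mul_of_nonneg_left (hC k) (norm_nonneg _)⟩
  -- a continuous linear projection onto `E'`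
  obtain ⟨Q, hQ⟩ := E'.exists_isCompl
  set π : E →L[ℂ] E' := LinearMap.toContinuousLinearMap (E'.projectionOnto Q hQ) with hπ
  have hπid : ∀ y : E', π (y : E) = y := fun y => Submodule.projectionOnto_apply_left hQ y
  set s' : Ω → E' := fun ω => π (s ω) with hs'
  have hs'c : Continuous s' := π.continuous.comp hs
  have hs'U : ∀ ω ∈ U, (s' ω : E) = s ω := fun ω hω => by
    simp only [hs']
    rw [show s ω = ((⟨s ω, hsmem ω hω⟩ : E') : E) from rfl, hπid]
  -- weak nullity transfers
  have hw' : ∀ (ℓ : E' →L[ℂ] ℂ) (F : Ω → ℂ), Continuous F → HasCompactSupport F →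
      tsupport F ⊆ U →
      Tendsto (fun k => ∫ ω, F ω * ℓ ((A' ^ k) (s' ω)) ∂μ) atTop (𝓝 0) := by
    intro ℓ F hFc hFcs hFts
    have heq : ∀ k, (fun ω => F ω * ℓ ((A' ^ k) (s' ω))) =
        fun ω => F ω * (ℓ.comp π) ((A ^ k) (s ω)) := by
      intro k
      funext ω
      by_cases hω : ω ∈ tsupport F
      · have hωU := hFts hω
        congr 1
        simp only [ContinuousLinearMap.comp_apply]
        congr 1
        have h1 : s' ω = ⟨s ω, hsmem ω hωU⟩ := Subtype.ext (hs'U ω hωU)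
        have h2 : (A ^ k) (s ω) = (((A' ^ k) ⟨s ω, hsmem ω hωU⟩ : E') : E) :=
          (hA'pow k ⟨s ω, hsmem ω hωU⟩).symm
        rw [h1, h2, hπid]
      · simp [image_eq_zero_of_notMem_tsupport hω]
    simp_rw [heq]
    exact hw (ℓ.comp π) F hFc hFcs hFts
  obtain ⟨C, θ, hC, hθ0, hθ1, hdec⟩ :=
    geometric_decay_of_weakNull_continuous (μ := μ) A' hb' hU hs'c hw'
  refine ⟨C, θ, hC, hθ0, hθ1, fun ω hω k => ?_⟩
  have h1 := hdec ω hω k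
  have h2 : ‖(A' ^ k) (s' ω)‖ = ‖(A ^ k) (s ω)‖ := by
    rw [Submodule.coe_norm, hA'pow, hs'U ω hω]
  rw [h2, Submodule.coe_norm, hs'U ω hω] at h1
  exact h1

end WeakNullContinuous

end Literature.Analysis.OperatorTheory
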